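import Literature.Probability.Moments.BiasedCubeSharpThreshold
import Literature.Probability.Percolation.RussoFormula
import HarnessLib

/-!
# The Talagrand-type sharp-threshold inequality for increasing events of bond percolation

Topic `Literature/Probability/Percolation`. Transfer of the finite-cube inequality
`BiasedCube.sharpThreshold_indicator` (`Literature/Probability/Moments/BiasedCubeSharpThreshold.lean`,
Rossignol 2006 / Talagrand 1994 via the log-Sobolev inequality) to Bernoulli bond percolation
`P_p` on a graph `G`: for an increasing event `A` determined by a finite set `F ⊆ E(G)` of edges,
with `t = P_p(A)` and `I_e = P_p(e is pivotal for A)`,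

  `t(1−t) · log( t(1−t) / (4p²(1−p)² Σ_{e∈F} I_e²) ) ≤ 2 Σ_{e∈F} I_e`   (`sharpThreshold_event`),

and `Σ_{e∈F} I_e = d P_p(A)/dp` by Russo's formula (`hasDerivAt_real_event`, from
`russo_formula_sum_holds`). This is the form of the "standard sharp threshold result for Boolean
functions [Tal94]" used by Duminil-Copin–Kozma–Tassion 2020, §4 (eq. (29)), up to the
corrections `log(t(1−t))` and `log(Σ I_e)`.

The transfer enumerates `F` (`F.equivFin`), identifies configurations `x ∈ {0,1}^{|F|}` with
sub-configurations `cfg x ⊆ F`, and computes `P_p` of an `F`-determined event as the cube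
expectation of its indicator (`Ep_indicator_eq_real`, via the cylinder decomposition
`DeterminedBy.eq_biUnion_localCylinder` / `Russo.setBernoulli_real_localCylinder`).

## References

* M. Talagrand, Ann. Probab. 22 (1994), Thm 1.1, Cor 1.2 [Talagrand1994].
* R. Rossignol, Ann. Probab. 34 (2006), Thm 2.1 [Rossignol2006].
* L. Russo, Z. Wahrsch. verw. Gebiete 56 (1981), Lemma 3 (Russo's formula) [RussoZW1981].
* H. Duminil-Copin, G. Kozma, V. Tassion, arXiv:1902.03207, §4 (29) [DuminilcopinKozmaTassion2020].
-/

noncomputable section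

namespace Literature.Probability.Percolation

namespace SharpThreshold

open _root_.MeasureTheory Finset Literature.Probability.Moments Literature.Probability.Moments.BiasedCube
open scoped Classical

variable {V : Type*} {G : SimpleGraph V} {F : Finset (Sym2 V)}

/-! ## Encoding sub-configurations of `F` by the cube `{0,1}^{|F|}` -/

/-- The enumeration of `F`. [folklore] -/
def enc (F : Finset (Sym2 V)) : Fin F.card ≃ {e // e ∈ F} := F.equivFin.symm

/-- The sub-configuration of `F` encoded by `x ∈ {0,1}^{|F|}`. [folklore] -/
def cfg (F : Finset (Sym2 V)) (x : Fin F.card → Bool) : Finset (Sym2 V) :=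
  (Finset.univ.filter fun i => x i = true).image fun i => ((enc F i : {e // e ∈ F}) : Sym2 V)

/-- Membership in `cfg F x`. [folklore] -/
theorem mem_cfg_iff {x : Fin F.card → Bool} {e : Sym2 V} :
    e ∈ cfg F x ↔ ∃ i, x i = true ∧ ((enc F i : {e // e ∈ F}) : Sym2 V) = e := by
  simp [cfg]

/-- `enc i ∈ cfg x ↔ x i`. [folklore] -/
theorem enc_mem_cfg_iff (x : Fin F.card → Bool) (i : Fin F.card) :
    ((enc F i : {e // e ∈ F}) : Sym2 V) ∈ cfg F x ↔ x i = true := by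
  rw [mem_cfg_iff]
  constructor
  · rintro ⟨j, hj, hji⟩
    have : j = i := (enc F).injective (Subtype.ext hji)
    rw [← this]; exact hj
  · intro h; exact ⟨i, h, rfl⟩

/-- `cfg x ⊆ F`. [folklore] -/
theorem cfg_subset (x : Fin F.card → Bool) : cfg F x ⊆ F := by
  intro e he
  obtain ⟨i, -, rfl⟩ := mem_cfg_iff.1 he
  exact (enc F i).2

/-- Decoding: the bits of a sub-configuration. [folklore] -/
def dec (F : Finset (Sym2 V)) (S : Finset (Sym2 V)) : Fin F.card → Bool := fun i => decide (((enc F i : {e // e ∈ F}) : Sym2 V) ∈ S)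

/-- `dec` inverts `cfg`. [folklore] -/
theorem dec_cfg (x : Fin F.card → Bool) : dec F (cfg F x) = x := by
  funext i
  simp only [dec, enc_mem_cfg_iff, Bool.decide_eq_true]

/-- `cfg` inverts `dec` on subsets of `F`. [folklore] -/
theorem cfg_dec {S : Finset (Sym2 V)} (hS : S ⊆ F) : cfg F (dec F S) = S := by
  ext e
  rw [mem_cfg_iff]
  constructor
  · rintro ⟨i, hi, rfl⟩
    simpa [dec] using hi
  · intro he
    refine ⟨(enc F).symm ⟨e, hS he⟩, ?_, ?_⟩
    · simp [dec, he]
    · simp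

/-- **The cube `{0,1}^{|F|}` is the powerset of `F`.** [folklore] -/
def cubeEquivPowerset (F : Finset (Sym2 V)) : (Fin F.card → Bool) ≃ {S // S ∈ F.powerset} where
  toFun x := ⟨cfg F x, Finset.mem_powerset.2 (cfg_subset x)⟩
  invFun S := dec F S.1
  left_inv x := dec_cfg x
  right_inv S := Subtype.ext (cfg_dec (Finset.mem_powerset.1 S.2))

/-- Setting a bit: `cfg (x^{i,1}) = insert (enc i) (cfg x)`. [folklore] -/
theorem cfg_update_true (x : Fin F.card → Bool) (i : Fin F.card) :
    (↑(cfg F (Function.update x i true)) : Set (Sym2 V)) = insert ((enc F i : {e // e ∈ F}) : Sym2 V) ↑(cfg F x) := by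
  ext e
  simp only [Finset.mem_coe, mem_cfg_iff, Set.mem_insert_iff]
  constructor
  · rintro ⟨j, hj, rfl⟩
    by_cases hji : j = i
    · subst hji; exact Or.inl rfl
    · rw [Function.update_of_ne hji] at hj; exact Or.inr ⟨j, hj, rfl⟩
  · rintro (rfl | ⟨j, hj, rfl⟩)
    · exact ⟨i, by simp, rfl⟩
    · by_cases hji : j = i
      · subst hji; exact ⟨j, by simp, rfl⟩
      · exact ⟨j, by rw [Function.update_of_ne hji]; exact hj, rfl⟩

/-- Clearing a bit: `cfg (x^{i,0}) = cfg x ∖ {enc i}`. [folklore] -/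
theorem cfg_update_false (x : Fin F.card → Bool) (i : Fin F.card) :
    (↑(cfg F (Function.update x i false)) : Set (Sym2 V)) = ↑(cfg F x) \ {((enc F i : {e // e ∈ F}) : Sym2 V)} := by
  ext e
  simp only [Finset.mem_coe, mem_cfg_iff, Set.mem_sdiff, Set.mem_singleton_iff]
  constructor
  · rintro ⟨j, hj, rfl⟩
    by_cases hji : j = i
    · subst hji; simp at hj
    · rw [Function.update_of_ne hji] at hj
      exact ⟨⟨j, hj, rfl⟩, fun h => hji ((enc F).injective (Subtype.ext h))⟩
  · rintro ⟨⟨j, hj, rfl⟩, hne⟩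
    have hji : j ≠ i := fun h => hne (by rw [h])
    exact ⟨j, by rw [Function.update_of_ne hji]; exact hj, rfl⟩

/-! ## Probabilities of `F`-determined events as cube expectations -/

/-- The cube weight of `x` is the cylinder weight of `cfg x` (all edges of `F` are edges of `G`). [folklore] -/
theorem w_eq_prod_weight (hF : (↑F : Set (Sym2 V)) ⊆ G.edgeSet) (p : unitInterval) (x : Fin F.card → Bool) :
    w (p : ℝ) x = ∏ e ∈ F, Russo.weight G.edgeSet (↑(cfg F x) : Set (Sym2 V)) e p := by
  unfold w
  rw [← Finset.prod_coe_sort F]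
  rw [← Fintype.prod_equiv (enc F) (fun i => wt (p : ℝ) (x i))
    (fun e => Russo.weight G.edgeSet (↑(cfg F x) : Set (Sym2 V)) (e : Sym2 V) p) ?_]
  intro i
  have heE : ((enc F i : {e // e ∈ F}) : Sym2 V) ∈ G.edgeSet := hF (enc F i).2
  simp only [Russo.weight, Finset.mem_coe, enc_mem_cfg_iff, heE, if_true]
  cases x i <;> simp [wt]

/-- **`P_p` of an event determined by `F ⊆ E(G)` is the cube expectation of its indicator.**
[cite: RussoZW1981, §4 Lemma 3 (proof: cylinder decomposition)] -/
theorem Ep_indicator_eq_real (hF : (↑F : Set (Sym2 V)) ⊆ G.edgeSet) {B : Set (BondConfig V)}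
    (hB : DeterminedBy B (↑F : Set (Sym2 V))) (p : unitInterval) :
    Ep (p : ℝ) (fun x => if (↑(cfg F x) : Set (Sym2 V)) ∈ B then (1 : ℝ) else 0) = (bondPercolation G p).real B := by
  rw [bondPercolation, Russo.measureReal_eq_cylPoly hB G.edgeSet p]
  unfold Ep Russo.cylPoly
  rw [← Finset.sum_coe_sort F.powerset]
  rw [← Fintype.sum_equiv (cubeEquivPowerset F) _ (fun S : {S // S ∈ F.powerset} =>
    if (↑(S : Finset (Sym2 V)) : Set (Sym2 V)) ∈ B then ∏ e ∈ F, Russo.weight G.edgeSet ↑(S : Finset (Sym2 V)) e p else 0) ?_]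
  intro x
  simp only [cubeEquivPowerset, Equiv.coe_fn_mk]
  split_ifs with h
  · rw [mul_one, w_eq_prod_weight hF]
  · rw [mul_zero]

/-! ## Pivotality -/

/-- For an increasing event, pivotality of `enc i` at `cfg x` is the cube pivotality of the bit `i`.
[cite: RussoZW1981, §4 Lemma 3 (proof)] -/
theorem isPivotal_cfg_iff {A : Set (BondConfig V)} (hA : IsUpperSet A) (x : Fin F.card → Bool) (i : Fin F.card) :
    IsPivotal A ((enc F i : {e // e ∈ F}) : Sym2 V) ↑(cfg F x) ↔
      (↑(cfg F (Function.update x i true)) : Set (Sym2 V)) ∈ A ∧ (↑(cfg F (Function.update x i false)) : Set (Sym2 V)) ∉ A := by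
  rw [cfg_update_true, cfg_update_false, IsPivotal]
  constructor
  · rintro (⟨h1, h2⟩ | ⟨h1, h2⟩)
    · exact ⟨h1, h2⟩
    · exact absurd (hA (Set.sdiff_subset.trans (Set.subset_insert _ _)) h1) h2
  · rintro ⟨h1, h2⟩; exact Or.inl ⟨h1, h2⟩

/-- The indicator of an increasing event, read on the cube. [folklore] -/
def ind (F : Finset (Sym2 V)) (A : Set (BondConfig V)) (x : Fin F.card → Bool) : ℝ :=
  if (↑(cfg F x) : Set (Sym2 V)) ∈ A then 1 else 0

/-- `ind` is `{0,1}`-valued. [folklore] -/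
theorem ind_eq_zero_or_one (A : Set (BondConfig V)) (x : Fin F.card → Bool) : ind F A x = 0 ∨ ind F A x = 1 := by
  unfold ind; split_ifs <;> simp

/-- `ind` of an increasing event is increasing in each bit. [folklore] -/
theorem ind_mono {A : Set (BondConfig V)} (hA : IsUpperSet A) (x : Fin F.card → Bool) (i : Fin F.card) :
    ind F A (Function.update x i false) ≤ ind F A (Function.update x i true) := by
  unfold ind
  have hsub : (↑(cfg F (Function.update x i false)) : Set (Sym2 V)) ⊆ ↑(cfg F (Function.update x i true)) := by
    rw [cfg_update_true, cfg_update_false]; exact Set.sdiff_subset.trans (Set.subset_insert _ _)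
  by_cases h : (↑(cfg F (Function.update x i false)) : Set (Sym2 V)) ∈ A
  · rw [if_pos h, if_pos (hA hsub h)]
  · rw [if_neg h]; split_ifs <;> norm_num

/-- **The cube pivotality of the bit `i` for `ind A` is the indicator of "`enc i` is pivotal for `A`".**
[cite: RussoZW1981, §4 Lemma 3 (proof)] -/
theorem piv_ind_eq {A : Set (BondConfig V)} (hA : IsUpperSet A) (x : Fin F.card → Bool) (i : Fin F.card) :
    piv i (ind F A) x = if IsPivotal A ((enc F i : {e // e ∈ F}) : Sym2 V) ↑(cfg F x) then 1 else 0 := by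
  rw [isPivotal_cfg_iff hA]
  unfold piv ind
  by_cases h1 : (↑(cfg F (Function.update x i true)) : Set (Sym2 V)) ∈ A <;>
    by_cases h0 : (↑(cfg F (Function.update x i false)) : Set (Sym2 V)) ∈ A <;> simp [h1, h0]
  -- the case `x^{i,1} ∉ A`, `x^{i,0} ∈ A` contradicts monotonicity
  exfalso
  have := ind_mono hA x i
  unfold ind at this
  rw [if_pos h0, if_neg h1] at this
  norm_num at this

/-- **`P_p(enc i pivotal for A) = E_p[piv_i (ind A)]`.** [cite: RussoZW1981, §4 Lemma 3 (proof)] -/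
theorem Ep_piv_ind_eq_real (hF : (↑F : Set (Sym2 V)) ⊆ G.edgeSet) {A : Set (BondConfig V)} (hA : IsUpperSet A)
    (hAF : DeterminedBy A (↑F : Set (Sym2 V))) (p : unitInterval) (i : Fin F.card) :
    Ep (p : ℝ) (piv i (ind F A)) = (bondPercolation G p).real {ω | IsPivotal A ((enc F i : {e // e ∈ F}) : Sym2 V) ω} := by
  have hdet : DeterminedBy {ω : BondConfig V | IsPivotal A ((enc F i : {e // e ∈ F}) : Sym2 V) ω} (↑F : Set (Sym2 V)) :=
    (Russo.determinedBy_isPivotal hAF _).mono (by intro e he; exact Finset.mem_coe.2 (Finset.mem_of_mem_erase (Finset.mem_coe.1 he)))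
  rw [← Ep_indicator_eq_real hF hdet p]
  congr 1
  funext x
  rw [piv_ind_eq hA]
  rfl

/-! ## The sharp-threshold inequality and Russo's formula for events -/

/-- **Talagrand-type sharp-threshold inequality for increasing events of bond percolation.**
For `0 < p < 1`, a finite `F ⊆ E(G)` and an increasing event `A` determined by `F`, with
`t = P_p(A)` and `I_e = P_p(e pivotal for A)`: if `0 < t(1−t)` and `Σ_{e∈F} I_e² > 0` then
`t(1−t) log( t(1−t) / (4p²(1−p)² Σ_{e∈F} I_e²) ) ≤ 2 Σ_{e∈F} I_e`.
[cite: Talagrand1994, Thm 1.1 and Cor 1.2] [cite: Rossignol2006, Thm 2.1] -/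
theorem sharpThreshold_event (hF : (↑F : Set (Sym2 V)) ⊆ G.edgeSet) {A : Set (BondConfig V)} (hA : IsUpperSet A)
    (hAF : DeterminedBy A (↑F : Set (Sym2 V))) (p : unitInterval) (hp0 : 0 < (p : ℝ)) (hp1 : (p : ℝ) < 1)
    (ht : 0 < (bondPercolation G p).real A * (1 - (bondPercolation G p).real A))
    (hI : 0 < ∑ e ∈ F, (bondPercolation G p).real {ω | IsPivotal A e ω} ^ 2) :
    (bondPercolation G p).real A * (1 - (bondPercolation G p).real A) *
        Real.log ((bondPercolation G p).real A * (1 - (bondPercolation G p).real A) /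
          (4 * (p : ℝ) ^ 2 * (1 - p) ^ 2 * ∑ e ∈ F, (bondPercolation G p).real {ω | IsPivotal A e ω} ^ 2)) ≤
      2 * ∑ e ∈ F, (bondPercolation G p).real {ω | IsPivotal A e ω} := by
  -- translate everything to the cube
  have ht' : (bondPercolation G p).real A = Ep (p : ℝ) (ind F A) := (Ep_indicator_eq_real hF hAF p).symm
  have hsum : ∀ (φ : ℝ → ℝ), ∑ e ∈ F, φ ((bondPercolation G p).real {ω | IsPivotal A e ω}) =
      ∑ i : Fin F.card, φ (Ep (p : ℝ) (piv i (ind F A))) := by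
    intro φ
    rw [← Finset.sum_coe_sort F, ← Fintype.sum_equiv (enc F) (fun i => φ (Ep (p : ℝ) (piv i (ind F A))))
      (fun e => φ ((bondPercolation G p).real {ω | IsPivotal A (e : Sym2 V) ω})) (fun i => by rw [Ep_piv_ind_eq_real hF hA hAF p i])]
  have hsum2 := hsum (fun r => r ^ 2)
  have hsum1 := hsum id
  simp only [id] at hsum1
  rw [ht', hsum2, hsum1]
  rw [ht'] at ht
  rw [hsum2] at hI
  exact sharpThreshold_indicator hp0 hp1 (ind_eq_zero_or_one A) (ind_mono hA) ht hI

/-- **Russo's formula for events determined by `F ⊆ E(G)`**: on `(0,1)`,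
`d/dp P_p(A) = Σ_{e∈F} P_p(e pivotal for A)`. [cite: RussoZW1981, §4 Lemma 3 (4.2)] -/
theorem hasDerivAt_real_event (hF : (↑F : Set (Sym2 V)) ⊆ G.edgeSet) {A : Set (BondConfig V)} (hA : IsUpperSet A)
    (hAF : DeterminedBy A (↑F : Set (Sym2 V))) {p : ℝ} (hp : p ∈ Set.Ioo (0 : ℝ) 1) :
    HasDerivAt (fun q : ℝ => (bondPercolation G (Set.projIcc 0 1 zero_le_one q)).real A)
      (∑ e ∈ F, (bondPercolation G (Set.projIcc 0 1 zero_le_one p)).real {ω | IsPivotal A e ω}) p := by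
  have h := russo_formula_sum_holds G hA F hAF p hp
  refine h.congr_deriv (Finset.sum_congr rfl fun e he => ?_)
  congr 1
  ext ω
  simp only [Set.mem_setOf_eq, and_iff_right_iff_imp]
  exact fun _ => hF (Finset.mem_coe.2 he)

end SharpThreshold

end Literature.Probability.Percolation

end
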